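import Literature.AnabelianGeometry.EtaleTheta.DivisorMonoidsConstants34
import Literature.AnabelianGeometry.EtaleTheta.Discharge.Sec3Remark363OfRlfWeak
import Literature.AnabelianGeometry.EtaleTheta.Discharge.Sec3Thm37OfInputsWeak
import HarnessLib

/-!
# [EtTh] §3 at the weak constructed Def. 3.6 (i) data: the Def. 3.6 (ii)(b) bracketed sentence, row C38-L05,
# Remark 3.6.3 and the Theorem 3.7 END KNIT fed BY NAME from abc-iut-L2-t3's binder of record `DivisorMonoids.Prop34Const`

S. Mochizuki, *The étale theta function …*, Publ. RIMS **45** (2009) [MochizukiEtTh2009], Prop. 3.4 (ii) PDF p.74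
(third isomorphism "`L^× ⥲ F₀(Y^log)`" and "`div₀(c) = v_L(c)·div(ϖ_L)`"), Def. 3.6 (ii)(b) p.77, Rmk. 3.6.3 pp.78–79,
Thm. 3.7 pp.79–80, Cor. 3.8 p.81.

abc-iut cell, layer L2, row «§3 WEAK COLUMN at Λ = ℚ/ℝ» piece (W6), seat abc-iut-L6-t12 (gen 4).  abc-iut-L2-lead
ruling R206 (3): §3 consumers take the Prop. 3.4 (ii)-third-isomorphism inputs `hF₀inv` / `hcyc` / `hcn` through the ONE
predicate bundle `(hC : dm.Prop34Const)` of `DivisorMonoidsConstants34.lean` (abc-iut-L2-t3, p434595) BY NAME.  That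
file feeds the STRONG-constructor closers (`exists_cnstFn_effective_ofRlf{Z,Q,R}_of_prop34Const`); this proof-only
companion does the same for the WEAK-constructor closers of `Sec3FLambdaInvOfRlfWeak` / `Sec3ConstantLineOfRlfWeak` /
`Sec3Remark363OfRlfWeak` / `Sec3Thm37OfInputsWeak` (the data `ofRlfZWeak` / `ofRlfQWeak` / `ofRlfRWeak` of the
`Ÿ` / `Z_∞`-type coverings, cell finding F-L2d2-1), one `…_of_prop34Const` corollary per closer:

* `RealifiedDivisorMonoids.ofRlfQWeak_hFinv_of_prop34Const`, `ofRlfZWeak_hFinv_of_prop34Const`;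
* `TemperedFrobenioid.exists_cnstFn_effective_ofRlf{Z,Q,R}Weak_of_prop34Const` — Def. 3.6 (ii)(b) bracketed
  sentence ⇐ `Prop34Const` ALONE (no `Prop34`);
* `TemperedFrobenioid.bsFldPreStepLimitCriterion_ofRlf{Z,Q}Weak_of_prop34Const` ⇐ {`hF`, `Prop34`, `Prop34Const`, `hSup`};
* `TemperedFrobenioid.remark363_ofRlf{Z,Q}Weak_of_prop34Const` ⇐ {`Prop34`, `Prop34Const`} (`Λ = ℝ` is unconditional);
* `TemperedFrobenioid.thm37_ofRlfZWeak_of_inputs_of_cosetCnst_of_prop34Const` — the Thm 3.7 END KNIT third form with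
  `hcyc` read from the bundle: residual {`hBmon`, `hP34`, `hD`, `hnd`, `hrat`, `h34`, `h₀`, `hC`}.
PROOF-ONLY (0 defs); nothing restated.  HONEST FRAMING: refereed pre-IUT material; `Prop34Const` is a property of the
GENUINE geometric data recorded as a hypothesis, never asserted for abstract data; nothing here bears on [IUTchIII]
Cor. 3.12; typed ≠ proved.
-/

noncomputable section

namespace Literature.AnabelianGeometry.EtaleTheta

open CategoryTheory Opposite Literature.AlgebraicGeometry.Frobenioids Literature.AnabelianGeometry.SemiGraphs

universe u₀ v₀ u₁ u v w uK

namespace RealifiedDivisorMonoids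

variable {D₀ : Type u} [Category.{v} D₀] (dm : DivisorMonoids.{u, v, w} D₀)
  (hpf : ∀ Y : D₀ᵒᵖ, IsPerfFactorialCof (dm.Φ₀.obj Y))

/-- `hFinv` at `ofRlfZWeak` ⇐ `dm.Prop34Const` (its clause (a) IS `hF₀inv`). [cite: MochizukiEtTh2009, Prop 3.4 (ii) p.74] -/
theorem ofRlfZWeak_hFinv_of_prop34Const (hC : dm.Prop34Const) :
    ∀ (Y : D₀ᵒᵖ) (b : (ofRlfZWeak dm hpf).BΛ.obj Y), b ∈ (ofRlfZWeak dm hpf).FΛ Y →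
      ∃ b' ∈ (ofRlfZWeak dm hpf).FΛ Y, b' * b = 1 :=
  (ofRlfZWeak_hFinv_iff dm hpf).2 hC.hF₀inv

/-- `hFinv` at `ofRlfQWeak` ⇐ `dm.Prop34Const` (perfection of the inverse-closed `F₀`).
[cite: MochizukiEtTh2009, Def 3.6 p.76] -/
theorem ofRlfQWeak_hFinv_of_prop34Const (hC : dm.Prop34Const) :
    ∀ (Y : D₀ᵒᵖ) (b : (ofRlfQWeak dm hpf).BΛ.obj Y), b ∈ (ofRlfQWeak dm hpf).FΛ Y →
      ∃ b' ∈ (ofRlfQWeak dm hpf).FΛ Y, b' * b = 1 :=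
  ofRlfQWeak_hFinv_of' dm hpf hC.hF₀inv

end RealifiedDivisorMonoids

namespace TemperedFrobenioid

section BracketedSentence

variable {D₀ : Type u} [Category.{v} D₀] {dm : DivisorMonoids.{u, v, w} D₀}
  {hpf : ∀ Y : D₀ᵒᵖ, IsPerfFactorialCof (dm.Φ₀.obj Y)} {V : FrdIMonoidStub.{w}} {V₀ : FrdICatStub.{u, v, w} D₀}
  {D : Type u₀} [Category.{v₀} D] {VD : FrdICatStub.{u₀, v₀, w} D}

/-- **Def 3.6 (ii)(b), bracketed sentence, over `ofRlfZWeak dm hpf`** ⇐ `dm.Prop34Const` ALONE (no `Prop34`):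
`exists_cnstFn_effective_ofRlfZWeak_of_inv` with `hF₀inv`, `hcyc` read from the bundle. [cite: MochizukiEtTh2009, Def 3.6 p.77] -/
theorem exists_cnstFn_effective_ofRlfZWeak_of_prop34Const
    (C₀ : TemperedFrobenioid (RealifiedDivisorMonoids.ofRlfZWeak dm hpf) D VD) (hC : dm.Prop34Const) (A : Dᵒᵖ) :
    ∃ u : ((RealifiedDivisorMonoids.ofRlfZWeak dm hpf).BΛ.obj (C₀.baseOp A) : Type w) ×
        Algebra.GrothendieckGroup (C₀.Φ.carrier A),
      u ∈ C₀.cnstFn A ∧ ∃ Z : C₀.Φ.carrier A, Z ≠ 1 ∧ u.2 = Algebra.GrothendieckGroup.of Z :=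
  C₀.exists_cnstFn_effective_ofRlfZWeak_of_inv hC.hF₀inv hC.hcyc A

/-- **Def 3.6 (ii)(b), bracketed sentence, over `ofRlfQWeak dm hpf`** ⇐ `dm.Prop34Const` ALONE.
[cite: MochizukiEtTh2009, Def 3.6 p.77] -/
theorem exists_cnstFn_effective_ofRlfQWeak_of_prop34Const
    (C₀ : TemperedFrobenioid (RealifiedDivisorMonoids.ofRlfQWeak dm hpf) D VD) (hC : dm.Prop34Const) (A : Dᵒᵖ) :
    ∃ u : ((RealifiedDivisorMonoids.ofRlfQWeak dm hpf).BΛ.obj (C₀.baseOp A) : Type w) ×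
        Algebra.GrothendieckGroup (C₀.Φ.carrier A),
      u ∈ C₀.cnstFn A ∧ ∃ Z : C₀.Φ.carrier A, Z ≠ 1 ∧ u.2 = Algebra.GrothendieckGroup.of Z :=
  C₀.exists_cnstFn_effective_ofRlfQWeak_of_inv hC.hF₀inv hC.hcyc A

/-- **Def 3.6 (ii)(b), bracketed sentence, over `ofRlfRWeak dm hpf`** ⇐ `dm.Prop34Const` (only its `hcyc` is used;
`F₀^ℝ` is inverse-closed by construction, `ofRlfRWeak_hFinv`). [cite: MochizukiEtTh2009, Def 3.6 p.77] -/
theorem exists_cnstFn_effective_ofRlfRWeak_of_prop34Const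
    (C₀ : TemperedFrobenioid (RealifiedDivisorMonoids.ofRlfRWeak dm hpf) D VD) (hC : dm.Prop34Const) (A : Dᵒᵖ) :
    ∃ u : ((RealifiedDivisorMonoids.ofRlfRWeak dm hpf).BΛ.obj (C₀.baseOp A) : Type w) ×
        Algebra.GrothendieckGroup (C₀.Φ.carrier A),
      u ∈ C₀.cnstFn A ∧ ∃ Z : C₀.Φ.carrier A, Z ≠ 1 ∧ u.2 = Algebra.GrothendieckGroup.of Z :=
  C₀.exists_cnstFn_effective_ofRlfRWeak hC.hcyc A

/-- **Row C38-L05 over `ofRlfZWeak dm hpf`** ⇐ {`hF`, `dm.Prop34`, `dm.Prop34Const`, `hSup`} (`hcyc` from the bundle).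
[cite: MochizukiEtTh2009, Cor 3.8 p.81] -/
theorem bsFldPreStepLimitCriterion_ofRlfZWeak_of_prop34Const
    (C₀ : TemperedFrobenioid (RealifiedDivisorMonoids.ofRlfZWeak dm hpf) D VD)
    (hF : PreFrobenioid.IsFrobenioid C₀.toElem) (h34 : dm.Prop34 V V₀) (hC : dm.Prop34Const)
    (hSup : ∀ (W : D) (m : Perfection (C₀.divisorMonoid.obj (op W)))
      (U : Set (Perfection (C₀.divisorMonoid.obj (op W)))),
      U ⊆ C₀.bsFldPf W → U.Nonempty → (∀ u ∈ U, u ∣ m) → ∃ y ∈ C₀.bsFldPf W, (∀ u ∈ U, u ∣ y) ∧ y ∣ m) :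
    C₀.BsFldPreStepLimitCriterion (PreFrobenioidData.perfection hF) :=
  bsFldPreStepLimitCriterion_ofRlfZWeak C₀ hF h34 hC.hcyc hSup

/-- **Row C38-L05 over `ofRlfQWeak dm hpf`** ⇐ {`hF`, `dm.Prop34`, `dm.Prop34Const`, `hSup`}.
[cite: MochizukiEtTh2009, Cor 3.8 p.81] -/
theorem bsFldPreStepLimitCriterion_ofRlfQWeak_of_prop34Const
    (C₀ : TemperedFrobenioid (RealifiedDivisorMonoids.ofRlfQWeak dm hpf) D VD)
    (hF : PreFrobenioid.IsFrobenioid C₀.toElem) (h34 : dm.Prop34 V V₀) (hC : dm.Prop34Const)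
    (hSup : ∀ (W : D) (m : Perfection (C₀.divisorMonoid.obj (op W)))
      (U : Set (Perfection (C₀.divisorMonoid.obj (op W)))),
      U ⊆ C₀.bsFldPf W → U.Nonempty → (∀ u ∈ U, u ∣ m) → ∃ y ∈ C₀.bsFldPf W, (∀ u ∈ U, u ∣ y) ∧ y ∣ m) :
    C₀.BsFldPreStepLimitCriterion (PreFrobenioidData.perfection hF) :=
  bsFldPreStepLimitCriterion_ofRlfQWeak C₀ hF h34 hC.hcyc hSup

end BracketedSentence

section Remark363

variable {D₀ : Type u} [Category.{v} D₀] {dm : DivisorMonoids.{u, v, w} D₀}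
  {hpf : ∀ Y : D₀ᵒᵖ, IsPerfFactorialCof (dm.Φ₀.obj Y)} {V : FrdIMonoidStub.{w}} {V₀ : FrdICatStub.{u, v, w} D₀}
  {D : Type u₀} [Category.{v₀} D] {VD : FrdICatStub.{u₀, v₀, w} D}

/-- **Remark 3.6.3 at the weak `Λ = ℤ` data** ⇐ {`dm.Prop34`, `dm.Prop34Const`} (F-0581 instance form; `hF₀inv` from the
bundle). [cite: MochizukiEtTh2009, Rmk 3.6.3 p.79] -/
theorem remark363_ofRlfZWeak_of_prop34Const
    (C : TemperedFrobenioid (RealifiedDivisorMonoids.ofRlfZWeak dm hpf) D VD) (h34 : dm.Prop34 V V₀)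
    (hC : dm.Prop34Const) : TemperedFrobenioid.Remark363 (T := RealifiedDivisorMonoids.ofRlfZWeak dm hpf) C :=
  remark363_ofRlfZWeak C h34 hC.hF₀inv

/-- **Remark 3.6.3 at the weak `Λ = ℚ` data** ⇐ {`dm.Prop34`, `dm.Prop34Const`}. [cite: MochizukiEtTh2009, Rmk 3.6.3 p.79] -/
theorem remark363_ofRlfQWeak_of_prop34Const
    (C : TemperedFrobenioid (RealifiedDivisorMonoids.ofRlfQWeak dm hpf) D VD) (h34 : dm.Prop34 V V₀)
    (hC : dm.Prop34Const) : TemperedFrobenioid.Remark363 (T := RealifiedDivisorMonoids.ofRlfQWeak dm hpf) C :=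
  remark363_ofRlfQWeak C h34 hC.hF₀inv

end Remark363

section EndKnit

variable {D₀ : Type u₀} [Category.{v₀} D₀] {dm : DivisorMonoids.{u₀, v₀, w} D₀}
  {hpf : ∀ Y : D₀ᵒᵖ, IsPerfFactorialCof (dm.Φ₀.obj Y)} {V : FrdIMonoidStub.{w}} {V₀ : FrdICatStub.{u₀, v₀, w} D₀}
  {D : Type u} [Category.{v} D] {IsRational IsStrictlyRational : (Dᵒᵖ ⥤ CommMonCat.{w}) → Prop}
  (C₀ : TemperedFrobenioid (RealifiedDivisorMonoids.ofRlfZWeak dm hpf) D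
    (treeCatVocab D IsRational IsStrictlyRational))
  {GK : Type u₁} [Group GK] [TopologicalSpace GK] [SeparatelyContinuousMul GK] [CompactSpace GK]
  {cnst : D₀ ⥤ CosetCat GK} (p : ℕ) [Fact p.Prime]

/-- **[EtTh] Theorem 3.7 (i)–(iv) END KNIT (third form) at the weak `Λ = ℤ` data with `D^cnst = 𝓑(G)⁰`, `hcyc` read
from abc-iut-L2-t3's `Prop34Const`** — residual {`hBmon`, `hP34`, `hD`, `hnd`, `hrat`, `h34`, `h₀`, `hC`}.
[cite: MochizukiEtTh2009, Thm 3.7 p.79] -/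
theorem thm37_ofRlfZWeak_of_inputs_of_cosetCnst_of_prop34Const (hBmon : IsMonoidOn C₀.ratFnFunctor)
    (hP34 : ∀ A : Dᵒᵖ, ∃ L : PadicFrd.PadicFld.{uK} p, L.IsPadicLocal ∧
      Nonempty ((((RealifiedDivisorMonoids.ofRlfZWeak dm hpf).divΛ (C₀.baseOp A)).comp
        (Units.coeHom ((RealifiedDivisorMonoids.ofRlfZWeak dm hpf).BΛ.obj (C₀.baseOp A)))).ker ≃*
        PadicFrd.unitSubgroup L.K))
    (hD : IsOfFSMFFType D) (hnd : IsNonDilatingOn C₀.divisorMonoid)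
    (hrat : ∀ X : C₀.category,
      PreFrobenioidData.IsRational
        (PreFrobenioid.biratData (C₀.isFrobenioid_treeCatVocab_of_isMonoidOn hBmon)
          (PreFrobenioid.hasBiratSquares_of_isFrobenioid (C₀.isFrobenioid_treeCatVocab_of_isMonoidOn hBmon)))
        (S := PreFrobenioidData.ofFunctor C₀.divisorMonoid C₀.toElem) (fun a 𝔭 => PrimarySupp a 𝔭) X)
    (h34 : dm.Prop34 V V₀) (h₀ : dm.Prop34Cnst₀ cnst) (hC : dm.Prop34Const) :
    (PreFrobenioid.IsOfUnitProfiniteType C₀.toElem ∧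
      PreFrobenioid.IsOfIsotropicType C₀.toElem ∧
      PreFrobenioid.IsOfModelType C₀.toElem (C₀.isFrobenioid_treeCatVocab_of_isMonoidOn hBmon)
        (PreFrobenioid.hasBiratSquares_of_isFrobenioid (C₀.isFrobenioid_treeCatVocab_of_isMonoidOn hBmon)) ∧
      PreFrobenioidData.IsOfBiratFrobeniusNormalizedType
        (PreFrobenioid.biratData (C₀.isFrobenioid_treeCatVocab_of_isMonoidOn hBmon)
          (PreFrobenioid.hasBiratSquares_of_isFrobenioid (C₀.isFrobenioid_treeCatVocab_of_isMonoidOn hBmon))) ∧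
      PreFrobenioid.IsOfType (PreFrobenioid.IsSubQuasiFrobeniusTrivial C₀.toElem) ∧
      ¬ PreFrobenioid.IsOfType (PreFrobenioid.IsGroupLikeObj C₀.toElem)) ∧
    ((ModelFrobenioid.data C₀.divisorMonoid C₀.ratFnFunctor C₀.divBNatTrans).IsOfStandardType ∧
      (PreFrobenioidData.ofFunctor C₀.divisorMonoid C₀.toElem).IsOfRationallyStandardType
        (PreFrobenioid.rsParams (C₀.isFrobenioid_treeCatVocab_of_isMonoidOn hBmon) fun a 𝔭 => PrimarySupp a 𝔭)) ∧
    ((∀ A : C₀.category,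
        FrobenioidFacade.AutActionFactorsThrough (C₀.base ⋙ cnst) C₀.toElem A) ∧
      (∀ A : C₀.category, FrobenioidFacade.AutActionFaithful (C₀.base ⋙ cnst) C₀.toElem A)) ∧
    C₀.Thm37_iv :=
  C₀.thm37_ofRlfZWeak_of_inputs_of_cosetCnst p hBmon hP34 hD hnd hrat h34 h₀ hC.hcyc

end EndKnit

end TemperedFrobenioid

end Literature.AnabelianGeometry.EtaleTheta

end
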